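import Summits.Ventures.GridStability.Models.KronReductionDAE

/-!
# GridStability/Models/KronReductionDAELift — the converse lift (classical ⇒ structure-preserving DAE) and reciprocity of the reduced network

Cell `gridfusion` (LADDER-GRIDFUSION G3 model register), seat gridfusion-model-1; continuation of
`Models/KronReductionDAE.lean` (same namespace, same sources [cite: SauerPai1998, §7.9.2 (7.191)–(7.198),
§7.9.3 (7.205)–(7.212)] [galaxy:panama:353827995779076 p0130–p0131]). THREE COLUMNS: MODELLED column only
(MV-4 ↔ MV-2); no certificate, no sentence about any grid.

* `recoveredBus`, `networkState_recovered` — bus voltage phasors recovered from the rotor angles by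
  Kron's formula `V̄_B = −Ȳ_D⁻¹ Ȳ_C E∠δ` (model-1 `Kron.eliminatedVoltage`, p478163), polar form
  `V_k = ‖V̄_k‖`, `θ_k = arg V̄_k`;
* `isSolution_of_classical` — **every solution of model-1's `ClassicalSwing` ODE for the Kron-reduced
  record `kronClassical p g b` lifts, with the recovered bus voltages and `ω = ω_dev + ω_s`, to a solution
  of model-2's structure-preserving DAE (7.193)–(7.196) with constant-admittance loads** (`Ȳ_D`
  invertible; no `V ≠ 0` needed in this direction). With `classical_isSolutionOn_of_isSolution` this makes
  MV-4 (constant-impedance loads) and MV-2 the SAME dynamics on the machine variables;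
* `augmentedY_isSymm`, `kronClassical_symm` — a reciprocal network (`B` symmetric) has a symmetric
  augmented matrix, hence reciprocal reduced couplings `B_ij = B_ji`, `G_ij = G_ji` (`Kron.reduce_isSymm`) —
  the hypothesis of the cell's energy-function files, inherited rather than assumed.
-/

noncomputable section

open Matrix Complex Finset

namespace Summit.Ventures.GridStability.Models.StructurePreservingDAE.Params

variable {m n : ℕ} (p : Params m n)

/-! ## The converse: every classical solution lifts to a DAE solution (bus voltages by Kron recovery) -/

/-- Bus voltage PHASORS recovered from the rotor angles by Kron's formula `V̄_B = −Ȳ_D⁻¹ Ȳ_C Ē_A`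
(model-1 `Kron.eliminatedVoltage`). -/
def recoveredBus (g b : Fin n → ℝ) (δ : Fin m → ℝ) : Fin n → ℂ :=
  Kron.eliminatedVoltage (p.augmentedY g b) (Kron.phasor p.E δ)

/-- The polar form of the recovered phasors IS the network state used above:
`V_k = ‖V̄_k‖`, `θ_k = arg V̄_k`. -/
theorem networkState_recovered (g b : Fin n → ℝ) (δ : Fin m → ℝ) :
    p.networkState δ (fun k => ‖p.recoveredBus g b δ k‖) (fun k => Complex.arg (p.recoveredBus g b δ k))
      = Sum.elim (Kron.phasor p.E δ) (p.recoveredBus g b δ) := by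
  funext x
  rcases x with i | k
  · rfl
  · simp only [networkState, Sum.elim_inr, busPhasor]
    exact Complex.norm_mul_exp_arg_mul_I _

/-- **Classical internal-node solution ⇒ structure-preserving DAE solution (constant-admittance loads).**
Conversely to `classical_isSolutionOn_of_isSolution`: if `(δ, ω_dev)` solves model-1's `ClassicalSwing`
ODE for the Kron-reduced record on all of `ℝ` and `Ȳ_D` is invertible, then with the bus voltages
RECOVERED by Kron's formula (`V_k = ‖V̄_k‖`, `θ_k = arg V̄_k`, `V̄ = −Ȳ_D⁻¹Ȳ_C E∠δ`) and
`ω = ω_dev + ω_s`, the quadruple `(δ, ω, V, θ)` solves model-2's structure-preserving DAE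
(7.193)–(7.196) with the loads `P_Lk(V) = −g_k V²`, `Q_Lk(V) = b_k V²`. No `V ≠ 0` hypothesis is needed
in this direction. Together: MV-4 with constant-impedance loads and MV-2 are the SAME dynamics on the
machine variables. [cite: SauerPai1998, §7.9.2–§7.9.3] -/
theorem isSolution_of_classical {g b : Fin n → ℝ}
    (hPL : ∀ k v, p.PL k v = -(g k) * v ^ 2) (hQL : ∀ k v, p.QL k v = b k * v ^ 2)
    (hD : IsUnit (p.augmentedY g b).toBlocks₂₂.det) (hM : ∀ i, p.M i ≠ 0)
    {δ ωd : ℝ → Fin m → ℝ}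
    (hc : (p.kronClassical g b).IsSolutionOn (fun t => (δ t, ωd t)) Set.univ) :
    p.IsSolution δ (fun t i => ωd t i + p.ωs)
      (fun t k => ‖p.recoveredBus g b (δ t) k‖) (fun t k => Complex.arg (p.recoveredBus g b (δ t) k)) := by
  -- derivatives of the two halves of the classical state
  have hδ : ∀ t i, HasDerivAt (fun s => δ s i) (ωd t i) t := by
    intro t i
    have h := ((hc t (Set.mem_univ t)).hasFDerivWithinAt.fst).hasDerivWithinAt.hasDerivAt Filter.univ_mem
    simpa [ClassicalSwing.field] using (hasDerivAt_pi.1 h) i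
  have hω : ∀ t i, HasDerivAt (fun s => ωd s i)
      (((p.kronClassical g b).P i - (p.kronClassical g b).Pe (δ t) i
        - (p.kronClassical g b).D i * ωd t i) / (p.kronClassical g b).M i) t := by
    intro t i
    have h := ((hc t (Set.mem_univ t)).hasFDerivWithinAt.snd).hasDerivWithinAt.hasDerivAt Filter.univ_mem
    simpa [ClassicalSwing.field] using (hasDerivAt_pi.1 h) i
  -- KCL at the recovered state, hence the balances and `P_G = P_e`
  have hkcl : ∀ t k, (p.augmentedY g b *ᵥ p.networkState (δ t) (fun k => ‖p.recoveredBus g b (δ t) k‖)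
      (fun k => Complex.arg (p.recoveredBus g b (δ t) k))) (Sum.inr k) = 0 := by
    intro t k
    rw [networkState_recovered]
    exact Kron.network_equations_eliminatedVoltage _ hD _ k
  have hbal := fun t k => p.busPhasor_mul_conj_busCurrent hPL hQL (δ t)
    (fun k => ‖p.recoveredBus g b (δ t) k‖) (fun k => Complex.arg (p.recoveredBus g b (δ t) k)) k
  refine ⟨fun i => fun t => (hδ t i).differentiableAt,
    fun i => fun t => ((hω t i).add_const p.ωs).differentiableAt, ?_, ?_, ?_, ?_⟩
  · intro t i
    rw [(hδ t i).deriv]; ring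
  · intro t i
    rw [((hω t i).add_const p.ωs).deriv,
      p.PG_eq_Pe_of_kcl g b hD (δ t) _ _ (hkcl t) i]
    have hMeq : (p.kronClassical g b).M i = p.M i := rfl
    have hPeq : (p.kronClassical g b).P i = p.TM i := rfl
    have hDeq : (p.kronClassical g b).D i = 0 := rfl
    rw [hMeq, hPeq, hDeq]
    field_simp [hM i]
    ring
  · intro t k
    have h := hbal t k
    rw [hkcl t k, map_zero, mul_zero] at h
    have hre := congrArg Complex.re h
    simp only [Complex.zero_re] at hre
    linarith
  · intro t k
    have h := hbal t k
    rw [hkcl t k, map_zero, mul_zero] at h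
    have him := congrArg Complex.im h
    simp only [Complex.zero_im] at him
    linarith

/-! ## Reciprocity of the reduced record -/

/-- The augmented matrix of a reciprocal (symmetric-`B`) network is symmetric. -/
theorem augmentedY_isSymm (g b : Fin n → ℝ) (hB : ∀ k l, p.B k l = p.B l k) :
    (p.augmentedY g b).IsSymm := by
  rw [augmentedY, Matrix.isSymm_fromBlocks_iff]
  refine ⟨Matrix.isSymm_diagonal _, ?_, ?_, ?_⟩
  · ext k i; simp [Matrix.transpose_apply]
  · ext i k; simp [Matrix.transpose_apply]
  · ext k l
    simp only [Matrix.transpose_apply, Matrix.of_apply, hB l k]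
    by_cases hkl : k = l
    · subst hkl; rfl
    · simp [hkl, Ne.symm hkl]

/-- Hence the Kron-reduced couplings are symmetric: `B_ij = B_ji` and `G_ij = G_ji` for the reduced
record (the reciprocity hypothesis of the cell's energy-function files), from `Kron.reduce_isSymm`. -/
theorem kronClassical_symm (g b : Fin n → ℝ) (hB : ∀ k l, p.B k l = p.B l k) (i j : Fin m) :
    (p.kronClassical g b).B i j = (p.kronClassical g b).B j i ∧
      (p.kronClassical g b).G i j = (p.kronClassical g b).G j i := by
  have h := (Kron.reduce_isSymm (p.augmentedY_isSymm g b hB)).apply i j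
  simp only [kronClassical, Kron.classicalOfNetwork]
  exact ⟨by rw [h], by rw [h]⟩

end Summit.Ventures.GridStability.Models.StructurePreservingDAE.Params

end
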